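import Literature.AnabelianGeometry.EtaleTheta.Discharge.Sec4NestedRootFixednessThetaTwistTower
import Literature.AnabelianGeometry.EtaleTheta.Discharge.Sec5ThetaProperHThetaSmallIndex
import HarnessLib

/-!
# [EtTh] Def. 4.1 (iii) «fixed by `H_A`» at the junction's CARRIER OF RECORD (small index, theta function `Θ̈` PROPER): the exact obstruction —
# an anchor `M` carrying a `Θ̈`-Kummer class `≢ 0 (mod l)` admits NO `H_A`-fixed `l`-th root of `Θ̈` above it (the faithful shape of the Ÿ-anchor)

S. Mochizuki, *The étale theta function …*, Publ. RIMS **45** (2009) [MochizukiEtTh2009], Def. 4.1 (ii)(iii) p.313 (PDF p.87), Prop. 4.2 p.314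
(PDF p.88), Prop. 5.2 (i) p.324 (PDF p.98), §1 p.241 (PDF p.15) (the Kummer class `η̈^Θ` of `Θ̈`: non-trivial mod `l` on `Δ_Θ ⊆ Π^tp_Ÿ`).
[cite: MochizukiEtTh2009, Def 4.1 (iii) p.313 (PDF p.87)]  PAGE CONVENTION for [EtTh]: «printed N (PDF p.M)», N = M + 226.

PROOF-ONLY (theorems only; abc-iut cell, layer L2, seat abc-iut-L2-d2 gen 8; abc-iut-L2-lead R1408 «repr twin GO», the kernel form of correction
(C2) of record).  Companion of `Discharge/Sec4NestedRootFixednessThetaTwistTower.lean` (p518033: at the fourth-model sockets, `θ = Θ̈_n` the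
ROOT-unit with PRIMITIVE skeleton, the S-anchored nested root datum is EMPTY for every `l ≥ 2`).  Here the carrier is abc-iut-L2-t3's small-index
model `temperedFrobenioidSmall` with its quotient socket `settingSmall R S X φ hφ NH M` (`M ≤ Ker φ₃`, anchor `(Compat₃′/M, 0)`, `H_⊙ = φ⁻¹(M)`),
and the function is this seat's `Θ̈` PROPER (`thetaProperUnitQuot`, p512057), whose skeleton `N_m·(0,0,0,1)` is NOT primitive — so `l`-th roots
of `Θ̈` DO exist at the same level whenever `l ∣ N_m`, and the obstruction is EXACTLY the `Θ̈`-Kummer classes of `M` modulo `l`: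
* §1 `repr`-plumbing (the model's data at `A` are FILE 4's at the coset re-presentation `repr A ≅ A`): pointwise composition / identity / counit
  naturality / hom–inv laws for `reprIso`, the birational action and the pull-back of units on the `B₀`-component, pointwise.
* §2 **`actFn_apply_of_isFixedByHA_small`** — in `settingSmall … M`: an `H_⊙`-ample `A` and an `H_A`-FIXED `f ∈ O^×(A^birat)` have
  `k · f(s_A) = f(s_A)` for EVERY `k ∈ M`, `s_A ∈ gset (repr A^bs)` the re-presented Galois base point.
* §3 the pure Kummer element with `Θ̈`-class an INTEGER `c` at every index acts at level `m` by `ζ ↦ ζ·ζ_m^{t c}`; the `Θ̈`-exponent of `Θ̈` proper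
  is `N_m` at every point; **`not_isFixedByHA_of_pow_eq_thetaProper_of_mem`**: if `M ∋ k` pure-Kummer with `Θ̈`-class `c`, `l ∤ c`, then NO
  `H_⊙`-ample `A → A′ → A_⊙` carries an `H_A`-fixed `g` with `g^l = Θ̈|` — `l·t = N_m` at `s_A` and `N_m ∣ t·c` force `l ∣ c`; hence
  **`isEmpty_nthRoot_nested_thetaProper_of_mem`** (every `N`, every `l`-th root `Rl`, transport `pullFracModel`).  For `V_j`-type anchors
  (`j ≥ l − 1`, all classes `≡ 0 mod l`) this obstruction is void — inhabitation there is OPEN (the re-anchored Prop. 4.2 (iii) problem), as booked.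
HONEST FRAMING: class-(b) combinatorial DESIGN carrier (NOT the tempered Frobenioid of a Tate curve); the hypothesis «`M ∋` a class `≢ 0 (mod l)`»
is the faithful SHAPE of print's Ÿ-anchor (image of a generator of `Δ_Θ`), a HYPOTHESIS on the design-only onto-socket `φ` (R1257), not
discharged here; nothing here bears on [IUTchIII] Cor. 3.12; no side taken; typed ≠ proved.
-/

noncomputable section

namespace Literature.AnabelianGeometry.EtaleTheta

open CategoryTheory Opposite Function Literature.AlgebraicGeometry.Frobenioids Literature.AlgebraicGeometry.Frobenioids.QuasiTemperoid
  Literature.AlgebraicGeometry.Frobenioids.QuasiTemperoid.BTempConnected Literature.AnabelianGeometry.SemiGraphs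
  Literature.AnabelianGeometry.SemiGraphs.GaloisObjects LogDivisorModel LogDivisorModel.GaloisAction LogDivisorTower

namespace ThetaTwistTowerSmallIndex

open ThetaTwistTowerTempered LogDivisorModel.TateTowerThetaTwist TateTowerKummerTwistRShear
open TateTowerKummerTwist (M N N_dvd_M eN eN_pos N_mul_eN eN_mul_eN res)
open TateTowerKummerTwistR (Kum resK resK_apply)

/-! ## §1 `repr`-plumbing: pointwise laws in `B^temp(Compat₃′)⁰` and the model's data at the coset re-presentation -/

section Repr

variable {A B C : ConnectedPart (BTemp (Compat 3 thetaShear))}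

/-- Composition in `B^temp(Compat₃′)⁰` is composition of the underlying maps, pointwise. [cite: MochizukiFrdII2008, Ex 1.3 (ii) p.11] -/
theorem comp_apply₃ (f : A ⟶ B) (g : B ⟶ C) (s : (gset A).V) : (f ≫ g).hom.hom.hom s = g.hom.hom.hom (f.hom.hom.hom s) := rfl

/-- The identity of `B^temp(Compat₃′)⁰` is the identity map, pointwise. [cite: MochizukiFrdII2008, Ex 1.3 (ii) p.11] -/
theorem id_apply₃ (s : (gset A).V) : (𝟙 A : A ⟶ A).hom.hom.hom s = s := rfl

/-- `e⁻¹ (e s) = s` for the coset re-presentation `e : repr A ≅ A`, pointwise. [cite: MochizukiFrdII2008, Ex 1.3 (i) p.11] -/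
theorem reprIso_inv_hom_apply (s : (gset (repr A)).V) : (reprIso A).inv.hom.hom.hom ((reprIso A).hom.hom.hom.hom s) = s :=
  (comp_apply₃ (reprIso A).hom (reprIso A).inv s).symm.trans
    ((congrArg (fun h : repr A ⟶ repr A => h.hom.hom.hom s) (reprIso A).hom_inv_id).trans (id_apply₃ s))

/-- `e (e⁻¹ x) = x`, pointwise. [cite: MochizukiFrdII2008, Ex 1.3 (i) p.11] -/
theorem reprIso_hom_inv_apply (x : (gset A).V) : (reprIso A).hom.hom.hom.hom ((reprIso A).inv.hom.hom.hom x) = x :=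
  (comp_apply₃ (reprIso A).inv (reprIso A).hom x).symm.trans
    ((congrArg (fun h : A ⟶ A => h.hom.hom.hom x) (reprIso A).inv_hom_id).trans (id_apply₃ x))

/-- **Naturality of the coset re-presentation, pointwise**: `e_B (repr(g) s) = g (e_A s)`. [cite: MochizukiFrdII2008, Ex 1.3 (i) p.11] -/
theorem reprIso_naturality_apply (g : A ⟶ B) (s : (gset (repr A)).V) :
    (reprIso B).hom.hom.hom.hom ((toConn.map (equivConn.inverse.map g)).hom.hom.hom s) = g.hom.hom.hom ((reprIso A).hom.hom.hom.hom s) := by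
  have h := equivConn.counitIso.hom.naturality g
  have h' := congrArg (fun m : repr A ⟶ B => m.hom.hom.hom s) h
  exact h'

variable (R S : ((ConnectedPart (BTemp (Compat 3 thetaShear)))ᵒᵖ ⥤ CommMonCat.{0}) → Prop)

/-- The birational action at the small-index model, on the `B₀`-component, pointwise: `(σ·f)(s) = f(repr(Base σ⁻¹)(s))`.
[cite: MochizukiEtTh2009, Def 4.1 (ii) p.313 (PDF p.87)] -/
theorem biratAutModel_fst_apply_small {A : (temperedFrobenioidSmall R S).category} (σ : Aut A) (f : (temperedFrobenioidSmall R S).biratUnitsModel A)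
    (s : (gset (repr A.base)).V) :
    ((((temperedFrobenioidSmall R S).biratAutModel A σ f : (temperedFrobenioidSmall R S).biratUnitsModel A) :
        (temperedFrobenioidSmall R S).ratFnFunctor.obj (op A.base)).1.1).1 s =
      (((f : (temperedFrobenioidSmall R S).ratFnFunctor.obj (op A.base)).1.1).1
        ((toConn.map (equivConn.inverse.map (ModelFrobenioid.baseMap σ.inv))).hom.hom.hom s)) := by
  show towerC₃sf.resFn _ ((((f : (temperedFrobenioidSmall R S).ratFnFunctor.obj (op A.base)).1.1).1
    ((toConn.map (equivConn.inverse.map (ModelFrobenioid.baseMap σ.inv))).hom.hom.hom s))) = _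
  exact towerC₃sf.resFn_refl _ _

/-- Pull-back of units at the small-index model, on the `B₀`-component, pointwise: `(ψ^* w)(s) = res (w (repr(Base ψ)(s)))`.
[cite: MochizukiEtTh2009, Prop 4.2 p.314 (PDF p.88)] -/
theorem pullFracModel_fst_apply_small {A B : (temperedFrobenioidSmall R S).category} (ψ : A ⟶ B) (w : (temperedFrobenioidSmall R S).biratUnitsModel B)
    (s : (gset (repr A.base)).V) :
    ((((temperedFrobenioidSmall R S).pullFracModel ψ w : (temperedFrobenioidSmall R S).biratUnitsModel A) :
        (temperedFrobenioidSmall R S).ratFnFunctor.obj (op A.base)).1.1).1 s =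
      towerC₃sf.resFn ((levelsC 3 thetaShear).closure_lvl_mono (toConn.map (equivConn.inverse.map (ModelFrobenioid.baseMap ψ))))
        ((((w : (temperedFrobenioidSmall R S).ratFnFunctor.obj (op B.base)).1.1).1
          ((toConn.map (equivConn.inverse.map (ModelFrobenioid.baseMap ψ))).hom.hom.hom s))) := rfl

/-- Hence the `Θ̈`-exponent of a pulled-back unit at a point is `e` times that of the unit at the image point.
[cite: MochizukiEtTh2009, Prop 4.2 p.314 (PDF p.88)] -/
theorem eT_pullFracModel_fst_apply_small {A B : (temperedFrobenioidSmall R S).category} (ψ : A ⟶ B)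
    (w : (temperedFrobenioidSmall R S).biratUnitsModel B) (s : (gset (repr A.base)).V) :
    TateTowerTheta.eT (Multiplicative.toAdd (((((temperedFrobenioidSmall R S).pullFracModel ψ w : (temperedFrobenioidSmall R S).biratUnitsModel A) :
        (temperedFrobenioidSmall R S).ratFnFunctor.obj (op A.base)).1.1).1 s).1.2) =
      (eN (lvlC 3 thetaShear (repr B.base)) (lvlC 3 thetaShear (repr A.base)) : ℤ) *
        TateTowerTheta.eT (Multiplicative.toAdd ((((w : (temperedFrobenioidSmall R S).ratFnFunctor.obj (op B.base)).1.1).1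
          ((toConn.map (equivConn.inverse.map (ModelFrobenioid.baseMap ψ))).hom.hom.hom s)).1.2)) :=
  (congrArg (fun z : (towerC₃sf.Z (lvlC 3 thetaShear (repr A.base))).Fn => TateTowerTheta.eT (Multiplicative.toAdd z.1.2))
    (pullFracModel_fst_apply_small R S ψ w s)).trans (eT_toAdd_snd_resFn _ _)

end Repr

/-! ## §2 In `settingSmall … M`: an `H_A`-fixed birational unit takes an `M`-INVARIANT value at the re-presented Galois base point -/

section Setting

variable (R S : ((ConnectedPart (BTemp (Compat 3 thetaShear)))ᵒᵖ ⥤ CommMonCat.{0}) → Prop) {K : Type} [Field K]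
  (X : SemiGraphs.TemperedArithmeticGroup.{0} K) (NH : Subgroup (Field.absoluteGaloisGroup K) → (temperedFrobenioidSmall R S).category → ℕ+ → Prop)
  (φ : X.Pi →ₜ* Compat 3 thetaShear) (hφ : Function.Surjective φ) (M₀ : OpenNormalSubgroup (Compat 3 thetaShear))

set_option maxHeartbeats 4000000 in
-- ENGINEERING NOTE: the one definitional conversion `(settingSmall …).biratAut A = biratAutModel A` (true by `rfl`) costs ≈ 10× the default
-- heartbeat budget at the small-index model (the setting is a `def` over the equivalence-inverse base functor); it is isolated in this lemma so
-- that every other statement of the file is phrased in the model's own terms and elaborates at default budget (precedent: abc-iut-L2-t3's `Sec4Prop42iiiThetaTwistTowerClosureRange`, abc-iut-L2-lead R1363).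
/-- Def. 4.1 (iii)'s «fixed by `H_A`» in `settingSmall … M`, read in the model's terms: every `σ ∈ H_A` satisfies `B(Base σ⁻¹)(f) = f`.
[cite: MochizukiEtTh2009, Def 4.1 (iii) p.313 (PDF p.87)] -/
theorem biratAutModel_eq_of_isFixedByHA {A : (temperedFrobenioidSmall R S).category} (hA : IsGaloisObj A.base.obj)
    (f : (temperedFrobenioidSmall R S).biratUnitsModel A) (h : (settingSmall R S X φ hφ NH M₀).IsFixedByHA A hA f) (σ : Aut A)
    (hσ : σ ∈ (settingSmall R S X φ hφ NH M₀).HA A hA) : (temperedFrobenioidSmall R S).biratAutModel A σ f = f := by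
  have e := h σ hσ
  have hconv : (settingSmall R S X φ hφ NH M₀).biratAut A = (temperedFrobenioidSmall R S).biratAutModel A := rfl
  rw [hconv] at e
  exact e

/-- **In `settingSmall R S X φ hφ NH M` (anchor `(Compat₃′/M, 0)`, `H_⊙ = φ⁻¹(M)`): an `H_⊙`-ample `A` and an `H_A`-FIXED `f ∈ O^×(A^birat)` have
`k · f(s_A) = f(s_A)` for every `k ∈ M`**, `s_A := e⁻¹(x_A)` the Galois base point of `A^bs` re-presented on `repr A^bs` (`H_⊙ ↠` the deck
transformations `x_A ↦ k⁻¹·x_A`, each lifting by ampleness; the lift transports `f` along `repr(Base σ⁻¹)`, which moves `s_A` to `k·s_A` by the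
naturality and equivariance of `e`). [cite: MochizukiEtTh2009, Def 4.1 (iii) p.313 (PDF p.87)] -/
theorem actFn_apply_of_isFixedByHA_small {A : (temperedFrobenioidSmall R S).category} (hA : IsGaloisObj A.base.obj)
    (hsurj : (settingSmall R S X φ hφ NH M₀).HAbs A hA ≤ ((settingSmall R S X φ hφ NH M₀).autBase A).range)
    (f : (temperedFrobenioidSmall R S).biratUnitsModel A)
    (hfix : ∀ σ : Aut A, σ ∈ (settingSmall R S X φ hφ NH M₀).HA A hA → (temperedFrobenioidSmall R S).biratAutModel A σ f = f)
    {k : Compat 3 thetaShear} (hk : k ∈ M₀.toSubgroup) :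
    (towerC₃sf.act (lvlC 3 thetaShear (repr A.base))).actFn k
        ((((f : (temperedFrobenioidSmall R S).ratFnFunctor.obj (op A.base)).1.1).1
          ((reprIso A.base).inv.hom.hom.hom (galoisBase (isTemperedC 3 thetaShear) A.base.obj hA)))) =
      (((f : (temperedFrobenioidSmall R S).ratFnFunctor.obj (op A.base)).1.1).1
        ((reprIso A.base).inv.hom.hom.hom (galoisBase (isTemperedC 3 thetaShear) A.base.obj hA))) := by
  -- (`cases` on the existentials is avoided on purpose: it triggers an expensive definitional unfolding of the setting in this context)
  let x : X.Pi := (hφ k).choose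
  have hx : φ x = k := (hφ k).choose_spec
  have hxH : x ∈ (settingSmall R S X φ hφ NH M₀).Hodot := by
    rw [settingSmall_Hodot, Subgroup.mem_comap]
    change φ x ∈ M₀.toSubgroup
    rw [hx]
    exact hk
  have hτ : (settingSmall R S X φ hφ NH M₀).galoisSurj A.base hA x ∈ (settingSmall R S X φ hφ NH M₀).HAbs A hA :=
    Subgroup.mem_map_of_mem _ hxH
  let σ : Aut A := (MonoidHom.mem_range.1 (hsurj hτ)).choose
  have hσ : (settingSmall R S X φ hφ NH M₀).autBase A σ = (settingSmall R S X φ hφ NH M₀).galoisSurj A.base hA x :=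
    (MonoidHom.mem_range.1 (hsurj hτ)).choose_spec
  have hσmem : σ ∈ (settingSmall R S X φ hφ NH M₀).HA A hA := by
    change σ ∈ Subgroup.comap _ _
    rw [Subgroup.mem_comap]
    exact (congrArg (· ∈ (settingSmall R S X φ hφ NH M₀).HAbs A hA) hσ).mpr hτ
  have hf : (temperedFrobenioidSmall R S).biratAutModel A σ f = f := hfix σ hσmem
  -- abbreviations: the iso `e`, the base point `x_A`, its re-presentation `s_A`
  have hpt := biratAutModel_fst_apply_small R S σ f ((reprIso A.base).inv.hom.hom.hom (galoisBase (isTemperedC 3 thetaShear) A.base.obj hA))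
  have hval := congrArg (fun u : (temperedFrobenioidSmall R S).biratUnitsModel A =>
    (((u : (temperedFrobenioidSmall R S).ratFnFunctor.obj (op A.base)).1.1).1
      ((reprIso A.base).inv.hom.hom.hom (galoisBase (isTemperedC 3 thetaShear) A.base.obj hA)))) hf
  have hb : ModelFrobenioid.baseMap σ.inv = ((settingSmall R S X φ hφ NH M₀).autBase A σ).inv := rfl
  -- `Base(σ⁻¹) = ρ_A(x)⁻¹` moves `x_A` to `k·x_A`
  have hmoveA : (ModelFrobenioid.baseMap σ.inv).hom.hom.hom (galoisBase (isTemperedC 3 thetaShear) A.base.obj hA) =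
      (gset A.base).ρ k (galoisBase (isTemperedC 3 thetaShear) A.base.obj hA) := by
    rw [hb, hσ, ← Iso.symm_hom, ← Aut.Aut_inv_def, ← map_inv]
    change ((galoisSurjOf (isTemperedC 3 thetaShear) A.base.obj hA (φ x⁻¹)).hom.hom.hom
      (galoisBase (isTemperedC 3 thetaShear) A.base.obj hA) : A.base.obj.obj.V) = _
    rw [galoisSurjOf_apply_base, map_inv φ x, inv_inv, hx]
  -- hence `repr(Base σ⁻¹)` moves `s_A = e⁻¹ x_A` to `k·s_A`
  have hmove : (toConn.map (equivConn.inverse.map (ModelFrobenioid.baseMap σ.inv))).hom.hom.hom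
        ((reprIso A.base).inv.hom.hom.hom (galoisBase (isTemperedC 3 thetaShear) A.base.obj hA)) =
      (gset (repr A.base)).ρ k ((reprIso A.base).inv.hom.hom.hom (galoisBase (isTemperedC 3 thetaShear) A.base.obj hA)) := by
    -- `e (repr(Base σ⁻¹) s_A) = Base(σ⁻¹) (e s_A) = Base(σ⁻¹) x_A = k·x_A = k·(e s_A) = e (k·s_A)`, then cancel `e`
    have e1 := reprIso_naturality_apply (ModelFrobenioid.baseMap σ.inv)
      ((reprIso A.base).inv.hom.hom.hom (galoisBase (isTemperedC 3 thetaShear) A.base.obj hA))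
    have e2 := (e1.trans ((congrArg (ModelFrobenioid.baseMap σ.inv).hom.hom.hom
      (reprIso_hom_inv_apply (A := A.base) (galoisBase (isTemperedC 3 thetaShear) A.base.obj hA))).trans hmoveA)).trans
      (((congrArg ((gset A.base).ρ k)
        (reprIso_hom_inv_apply (A := A.base) (galoisBase (isTemperedC 3 thetaShear) A.base.obj hA))).symm).trans
        (hom_ρ (reprIso A.base).hom.hom k _).symm)
    have e3 := congrArg (reprIso A.base).inv.hom.hom.hom e2
    exact ((reprIso_inv_hom_apply _).symm.trans e3).trans (reprIso_inv_hom_apply _)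
  have hρ := congrArg (((f : (temperedFrobenioidSmall R S).ratFnFunctor.obj (op A.base)).1.1).1) hmove
  exact ((((f : (temperedFrobenioidSmall R S).ratFnFunctor.obj (op A.base)).1.1).2.2 k
    ((reprIso A.base).inv.hom.hom.hom (galoisBase (isTemperedC 3 thetaShear) A.base.obj hA))).symm.trans
      (hρ.symm.trans (hpt.symm.trans hval)))

end Setting


/-! ## §3 `Θ̈` PROPER: the `Θ̈`-class of the anchor modulo `l` is the exact obstruction -/

section Theta

variable (m : ℕ)

/-- **A pure Kummer element with `Θ̈`-class an integer `c` at every index acts at level `m` by `ζ ↦ ζ·ζ_m^{t·c}`** (`t` the `Θ̈`-exponent;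
skeleton untouched). [cite: MochizukiEtTh2009, Def 3.3 (iii) p.299 (PDF p.73)] -/
theorem actFn_of_kummer_int {k : Compat 3 thetaShear} {c : ℤ} (hk1 : (k : Grp 3 thetaShear).right = 1)
    (hk2 : ∀ j, (k : Grp 3 thetaShear).left.toAdd j = fun a : Fin 3 => if a = 2 then (c : ZMod (M j)) else 0) (x : (towerC₃sf.Z m).Fn) :
    Multiplicative.toAdd ((towerC₃sf.act m).actFn k x).1.1 =
      Multiplicative.toAdd x.1.1 + TateTowerTheta.eT (Multiplicative.toAdd x.1.2) • (c : ZMod ((N m : ℕ+) : ℕ)) ∧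
    ((towerC₃sf.act m).actFn k x).1.2 = x.1.2 := by
  have hk : (k : Grp 3 thetaShear) = SemidirectProduct.inl (k : Grp 3 thetaShear).left := by
    rw [← SemidirectProduct.inl_left_mul_inr_right (k : Grp 3 thetaShear), hk1, map_one, mul_one, SemidirectProduct.left_inl]
  have e : ((towerC₃sf.act m).actFn k x).1 = levelActFnMod m ((N m : ℕ+) : ℕ) (N_dvd_M m) (k : Grp 3 thetaShear) x.1 := rfl
  rw [hk, levelActFnMod_inl, kumActMod_apply] at e
  refine ⟨?_, (congrArg Prod.snd e).trans (kummerAut_snd _ _)⟩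
  rw [show ((towerC₃sf.act m).actFn k x).1.1 = (levelActFnMod m ((N m : ℕ+) : ℕ) (N_dvd_M m) (k : Grp 3 thetaShear) x.1).1 from rfl]
  rw [hk, levelActFnMod_inl, kumActMod_apply, kummerAut_fst, toAdd_mul, toAdd_ofAdd, hk2 m, pairing]
  simp only [if_neg (show (0 : Fin 3) ≠ 2 by decide), if_neg (show (1 : Fin 3) ≠ 2 by decide), ite_true, map_zero, smul_zero,
    zero_add, map_intCast]

/-- Invariance under such an element at level `m` forces `N_m ∣ t·c`. [cite: MochizukiEtTh2009, Def 3.3 (iii) p.299 (PDF p.73)] -/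
theorem dvd_of_actFn_kummer_int_eq {k : Compat 3 thetaShear} {c : ℤ} (hk1 : (k : Grp 3 thetaShear).right = 1)
    (hk2 : ∀ j, (k : Grp 3 thetaShear).left.toAdd j = fun a : Fin 3 => if a = 2 then (c : ZMod (M j)) else 0) {x : (towerC₃sf.Z m).Fn}
    (hx : (towerC₃sf.act m).actFn k x = x) :
    (((N m : ℕ+) : ℕ) : ℤ) ∣ TateTowerTheta.eT (Multiplicative.toAdd x.1.2) * c := by
  have h := (actFn_of_kummer_int m hk1 hk2 x).1
  rw [hx, left_eq_add, zsmul_eq_mul, ← Int.cast_mul, ZMod.intCast_zmod_eq_zero_iff_dvd] at h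
  exact h

/-- The `Θ̈`-exponent of `Θ̈` PROPER at level `m` is `N_m` (`Θ̈ = Θ̈_m^{N_m}`). [cite: MochizukiEtTh2009, Prop 1.4 (i) p.247 (PDF p.21)] -/
theorem eT_thetaProper : TateTowerTheta.eT (Multiplicative.toAdd (thetaProper m).1.2) = (((N m : ℕ+) : ℕ) : ℤ) := by
  rw [thetaProper, eT_toAdd_snd_pow]
  exact mul_one _

variable (R S : ((ConnectedPart (BTemp (Compat 3 thetaShear)))ᵒᵖ ⥤ CommMonCat.{0}) → Prop)

/-- The `Θ̈`-exponent of the small-index section `Θ̈ ∈ B₀(A)` is `N_m` at EVERY point of `gset (repr A)` (`m` the covering's level).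
[cite: MochizukiEtTh2009, Prop 1.4 (ii) p.248 (PDF p.22)] -/
theorem eT_thetaProperB₀_apply (A : ConnectedPart (BTemp (Compat 3 thetaShear)))
    (hA : ∀ (s : (gset (repr A)).V) (g : Compat 3 thetaShear), (gset (repr A)).ρ g s = s → φ₃ g = 1) (s : (gset (repr A)).V) :
    TateTowerTheta.eT (Multiplicative.toAdd ((thetaProperB₀ A hA).1 s).1.2) = (((N (lvlC 3 thetaShear (repr A)) : ℕ+) : ℕ) : ℤ) := by
  obtain ⟨k, rfl⟩ := (isConnectedGSet_gset (repr A)).2 (pt A) s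
  have e : (thetaProperB₀ A hA).1 ((gset (repr A)).ρ k (pt A)) =
      (towerC₃sf.act (lvlC 3 thetaShear (repr A))).actFn k (thetaProper (lvlC 3 thetaShear (repr A))) := thetaProperFam_apply_ρ _ _ _ _ k
  rw [e, eT_toAdd_snd_actFn, eT_thetaProper]

variable {K : Type} [Field K] (X : SemiGraphs.TemperedArithmeticGroup.{0} K)
  (NH : Subgroup (Field.absoluteGaloisGroup K) → (temperedFrobenioidSmall R S).category → ℕ+ → Prop)
  (φ : X.Pi →ₜ* Compat 3 thetaShear) (hφ : Function.Surjective φ) (M₀ : OpenNormalSubgroup (Compat 3 thetaShear))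
  (hM₀ : ∀ g ∈ M₀.toSubgroup, φ₃ g = 1)

/-- The `B₀`-component of `Θ̈ ∈ O^×(A_⊙^birat)` at the anchor `(Compat₃′/M, 0)` IS the section `Θ̈ ∈ B₀(Compat₃′/M)`.
[cite: MochizukiEtTh2009, §5 p.330 (PDF p.104)] -/
theorem fst_coe_thetaProperUnitQuot :
    (thetaProperUnitQuot R S M₀ hM₀).val.1.1 =
      thetaProperB₀ (TemperedFrobenioid.quotConnObj isTempered_compat₃' M₀) (translationFree_repr_quotConnObj M₀ hM₀) :=
  congrArg (fun p : (temperedFrobenioidSmall R S).ratFnFunctor.obj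
      (op (AzeroSmall R S (TemperedFrobenioid.quotConnObj isTempered_compat₃' M₀)).base) => p.1.1)
    (coe_thetaProperUnit R S (TemperedFrobenioid.quotConnObj isTempered_compat₃' M₀) (translationFree_repr_quotConnObj M₀ hM₀))

/-- **THE EXACT OBSTRUCTION AT THE CARRIER OF RECORD**: in `settingSmall R S X φ hφ NH M` (`M ≤ Ker φ₃`), if the anchor group `M` contains a pure
Kummer element whose `Θ̈`-class is an integer `c` with `l ∤ c`, then NO `H_⊙`-ample `A → A′ → A_⊙` carries an `H_A`-fixed `g ∈ O^×(A^birat)` with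
`g^l = Θ̈|` — at `s_A` (level `m`): `l·t = N_m` from `g^l = Θ̈|` (the `Θ̈`-exponent of `Θ̈` proper is `N_m` everywhere) and `N_m ∣ t·c` from the
`M`-invariance, whence `l ∣ c`.  (For anchors all of whose classes are `≡ 0 (mod l)` — e.g. `V_j`, `j ≥ l−1` — there is no obstruction here.)
[cite: MochizukiEtTh2009, Def 4.1 (iii) p.313 (PDF p.87); §1 p.241 (PDF p.15)] -/
theorem not_isFixedByHA_of_pow_eq_thetaProper_of_mem {A A' : (temperedFrobenioidSmall R S).category} (ψ₂ : A ⟶ A')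
    (ψ₁ : A' ⟶ (temperedFrobenioidSmall R S).quotConnZeroObj isTempered_compat₃' M₀) (hA : IsGaloisObj A.base.obj)
    (hsurj : (settingSmall R S X φ hφ NH M₀).HAbs A hA ≤ ((settingSmall R S X φ hφ NH M₀).autBase A).range)
    (g : (temperedFrobenioidSmall R S).biratUnitsModel A)
    (hfix : ∀ σ : Aut A, σ ∈ (settingSmall R S X φ hφ NH M₀).HA A hA → (temperedFrobenioidSmall R S).biratAutModel A σ g = g)
    {k : Compat 3 thetaShear} (hk : k ∈ M₀.toSubgroup) {c : ℤ} (hk1 : (k : Grp 3 thetaShear).right = 1)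
    (hk2 : ∀ j, (k : Grp 3 thetaShear).left.toAdd j = fun a : Fin 3 => if a = 2 then (c : ZMod (M j)) else 0)
    {l : ℕ} (hc : ¬ ((l : ℤ) ∣ c))
    (hpow : g ^ l = (temperedFrobenioidSmall R S).pullFracModel ψ₂
      ((temperedFrobenioidSmall R S).pullFracModel ψ₁ (thetaProperUnitQuot R S M₀ hM₀))) : False := by
  -- levels `m_A ≤ m′ ≤ m` (read on the coset re-presentations)
  have h₁ : lvlC 3 thetaShear (repr ((temperedFrobenioidSmall R S).quotConnZeroObj isTempered_compat₃' M₀).base) ≤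
      lvlC 3 thetaShear (repr A'.base) := lvlC_le_of_hom 3 thetaShear (toConn.map (equivConn.inverse.map (ModelFrobenioid.baseMap ψ₁)))
  have h₂ : lvlC 3 thetaShear (repr A'.base) ≤ lvlC 3 thetaShear (repr A.base) :=
    lvlC_le_of_hom 3 thetaShear (toConn.map (equivConn.inverse.map (ModelFrobenioid.baseMap ψ₂)))
  -- the value of `g` at the re-presented Galois base point and its `Θ̈`-exponent `t`
  let y : (towerC₃sf.Z (lvlC 3 thetaShear (repr A.base))).Fn :=
    (((g : (temperedFrobenioidSmall R S).ratFnFunctor.obj (op A.base)).1.1).1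
      ((reprIso A.base).inv.hom.hom.hom (galoisBase (isTemperedC 3 thetaShear) A.base.obj hA)))
  -- (1) `M`-invariance under `k` ⟹ `N_m ∣ t·c`
  have hinv : (towerC₃sf.act (lvlC 3 thetaShear (repr A.base))).actFn k y = y :=
    actFn_apply_of_isFixedByHA_small R S X NH φ hφ M₀ hA hsurj g hfix hk
  have hdvd := dvd_of_actFn_kummer_int_eq (lvlC 3 thetaShear (repr A.base)) hk1 hk2 hinv
  -- (2) `g^l = Θ̈|` at the base point: `l·t = e(m′,m)·(e(m_A,m′)·N_{m_A}) = N_m`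
  have hl_pow : TateTowerTheta.eT (Multiplicative.toAdd
      ((((g ^ l : (temperedFrobenioidSmall R S).biratUnitsModel A) : (temperedFrobenioidSmall R S).ratFnFunctor.obj (op A.base)).1.1).1
        ((reprIso A.base).inv.hom.hom.hom (galoisBase (isTemperedC 3 thetaShear) A.base.obj hA))).1.2) =
      (l : ℤ) * TateTowerTheta.eT (Multiplicative.toAdd y.1.2) := by
    let ev : (temperedFrobenioidSmall R S).biratUnitsModel A →* (towerC₃sf.Z (lvlC 3 thetaShear (repr A.base))).Fn :=
      { toFun := fun u => (((u : (temperedFrobenioidSmall R S).ratFnFunctor.obj (op A.base)).1.1).1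
          ((reprIso A.base).inv.hom.hom.hom (galoisBase (isTemperedC 3 thetaShear) A.base.obj hA))),
        map_one' := rfl, map_mul' := fun _ _ => rfl }
    exact (congrArg (fun z : (towerC₃sf.Z (lvlC 3 thetaShear (repr A.base))).Fn => TateTowerTheta.eT (Multiplicative.toAdd z.1.2))
      (map_pow ev g l)).trans (eT_toAdd_snd_pow _ y l)
  have hr_pow : TateTowerTheta.eT (Multiplicative.toAdd
      (((((temperedFrobenioidSmall R S).pullFracModel ψ₂ ((temperedFrobenioidSmall R S).pullFracModel ψ₁ (thetaProperUnitQuot R S M₀ hM₀)) :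
        (temperedFrobenioidSmall R S).biratUnitsModel A) : (temperedFrobenioidSmall R S).ratFnFunctor.obj (op A.base)).1.1).1
        ((reprIso A.base).inv.hom.hom.hom (galoisBase (isTemperedC 3 thetaShear) A.base.obj hA))).1.2) =
      (eN (lvlC 3 thetaShear (repr A'.base)) (lvlC 3 thetaShear (repr A.base)) : ℤ) *
        ((eN (lvlC 3 thetaShear (repr ((temperedFrobenioidSmall R S).quotConnZeroObj isTempered_compat₃' M₀).base))
            (lvlC 3 thetaShear (repr A'.base)) : ℤ) *
          (((N (lvlC 3 thetaShear (repr ((temperedFrobenioidSmall R S).quotConnZeroObj isTempered_compat₃' M₀).base)) : ℕ+) : ℕ) : ℤ)) := by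
    rw [eT_pullFracModel_fst_apply_small, eT_pullFracModel_fst_apply_small, fst_coe_thetaProperUnitQuot, eT_thetaProperB₀_apply]
    rfl
  have hpow' := congrArg (fun u : (temperedFrobenioidSmall R S).biratUnitsModel A =>
    TateTowerTheta.eT (Multiplicative.toAdd ((((u : (temperedFrobenioidSmall R S).ratFnFunctor.obj (op A.base)).1.1).1
      ((reprIso A.base).inv.hom.hom.hom (galoisBase (isTemperedC 3 thetaShear) A.base.obj hA))).1.2))) hpow
  have heq : (l : ℤ) * TateTowerTheta.eT (Multiplicative.toAdd y.1.2) =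
      (((N (lvlC 3 thetaShear (repr A.base)) : ℕ+) : ℕ) : ℤ) := by
    refine hl_pow.symm.trans ((hpow'.trans hr_pow).trans ?_)
    rw [← Nat.cast_mul, mul_comm (eN _ _) (((N _ : ℕ+) : ℕ)), N_mul_eN h₁, ← Nat.cast_mul, mul_comm, N_mul_eN h₂]
  -- (3) arithmetic: `l·t = N_m` and `N_m ∣ t·c` force `l ∣ c`
  obtain ⟨q, hq⟩ := hdvd
  rw [← heq, mul_comm (l : ℤ), mul_assoc] at hq
  have ht : TateTowerTheta.eT (Multiplicative.toAdd y.1.2) ≠ 0 := by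
    intro h0
    rw [h0, mul_zero] at heq
    exact (Int.natCast_pos.2 (N (lvlC 3 thetaShear (repr A.base))).pos).ne' heq.symm
  exact hc ⟨q, mul_left_cancel₀ ht hq⟩

variable {l N : ℕ+}
  (Rl : (settingSmall R S X φ hφ NH M₀).NthRoot (thetaProperUnitQuot R S M₀ hM₀) (thetaProperFractionPairQuot R S X NH φ hφ M₀ hM₀) l
    (fun {_} ψ x => (temperedFrobenioidSmall R S).pullFracModel ψ x))

set_option maxHeartbeats 4000000 in -- see the ENGINEERING NOTE in §2 (the setting-typed root record is read in the model's terms)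
/-- **At the carrier of record, an anchor `M` with a `Θ̈`-class `≢ 0 (mod l)` REFUTES the S-anchored nested root datum** over the theta function
`Θ̈` proper (pull-back of record `pullFracModel`; every `N`) — the faithful shape of the junction's Ÿ-anchor (`M_Y ∋` the image of a generator of
`Δ_Θ`, class `1`).  [cite: MochizukiEtTh2009, Def 4.1 (iii) p.313 (PDF p.87); Prop 5.2 (i) p.324 (PDF p.98)] -/
theorem false_of_nthRoot_nested_thetaProper_of_mem {k : Compat 3 thetaShear} (hk : k ∈ M₀.toSubgroup) {c : ℤ}
    (hk1 : (k : Grp 3 thetaShear).right = 1)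
    (hk2 : ∀ j, (k : Grp 3 thetaShear).left.toAdd j = fun a : Fin 3 => if a = 2 then (c : ZMod (M j)) else 0) (hc : ¬ (((l : ℕ) : ℤ) ∣ c))
    (Rt : (settingSmall R S X φ hφ NH M₀).NthRoot Rl.root Rl.pair N (fun {_} ψ x => (temperedFrobenioidSmall R S).pullFracModel ψ x)) : False := by
  refine not_isFixedByHA_of_pow_eq_thetaProper_of_mem R S X NH φ hφ M₀ hM₀ Rt.αData.α₁ Rl.αData.α₁ Rt.isSaturated.isAmple.isGalois
    Rt.isSaturated.isAmple.surj ((temperedFrobenioidSmall R S).pullFracModel Rt.αData.α₁ Rl.root)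
    (biratAutModel_eq_of_isFixedByHA R S X NH φ hφ M₀ Rt.isSaturated.isAmple.isGalois _ Rt.isSaturated.fixed) hk hk1 hk2 hc ?_
  exact (map_pow ((temperedFrobenioidSmall R S).pullFracModel Rt.αData.α₁) Rl.root (l : ℕ)).symm.trans
    (congrArg ((temperedFrobenioidSmall R S).pullFracModel Rt.αData.α₁) Rl.pow_root)

set_option maxHeartbeats 4000000 in -- idem
/-- `IsEmpty` form of the refutation at the carrier of record. [cite: MochizukiEtTh2009, Prop 5.2 (i) p.324 (PDF p.98)] -/
theorem isEmpty_nthRoot_nested_thetaProper_of_mem {k : Compat 3 thetaShear} (hk : k ∈ M₀.toSubgroup) {c : ℤ}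
    (hk1 : (k : Grp 3 thetaShear).right = 1)
    (hk2 : ∀ j, (k : Grp 3 thetaShear).left.toAdd j = fun a : Fin 3 => if a = 2 then (c : ZMod (M j)) else 0) (hc : ¬ (((l : ℕ) : ℤ) ∣ c)) :
    IsEmpty ((settingSmall R S X φ hφ NH M₀).NthRoot Rl.root Rl.pair N (fun {_} ψ x => (temperedFrobenioidSmall R S).pullFracModel ψ x)) :=
  ⟨fun Rt => false_of_nthRoot_nested_thetaProper_of_mem R S X NH φ hφ M₀ hM₀ Rl hk hk1 hk2 hc Rt⟩

end Theta

end ThetaTwistTowerSmallIndex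

end Literature.AnabelianGeometry.EtaleTheta

end
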